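import Literature.AlgebraicGeometry.AbelianSchemes.IsogenyRoofAlongPointBaseChange   -- ★ p849602 `roof_readAt_comp`, `exists_pointsAlong_mulEquiv`, `pointsAlong_*` (LA4-p01)
import HarnessLib

/-!
# The isogeny roof along an isomorphism of point bases — TARGET MORPHISMS BY VALUE, POINCARÉ PINS AT THE POINTS

Topic `AlgebraicGeometry/AbelianSchemes`; namespace `Literature.AlgebraicGeometry.AbelianSchemes.AbelianSchemeOver`.  THEOREMS ONLY (no definition,
no named fact, no instance, no notation, no `sorry`); universe-polymorphic.  Cell `hodgecm-mathlib` (D-0151), P6 «MOD programme» (crux hLiu418 =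
stmt-HodgeConjecture-24832, `--supports`, count-neutral), line «L5» (LA5-plan (g3) EHECKE closer skeleton v4 47600b62, organ (O-T) `stub_ET` — «the Hecke
roofs read at the complex point `σ_* x′` on the sheet `τE♯` move to the `F̄_w`-point `x′` on the sheet `e′` along `σ : F̄_w ≃ ℂ`», paid by B-p08 (g34) with
these four wrappers in-skeleton; this file is their ★ home so that skeleton v5 imports them).

WHY.  ★ `IsogenyRoofAlongPointBaseChange` moves the five-clause roof shape of a PEL family `(𝒜, ρ, D, pol, lvl)` over `Y` read at two `Ω`-points
`ℓ₁, ℓ₂` to the points `x ≫ ℓ₁, x ≫ ℓ₂` for an isomorphism `x : Spec Ω′ ⟶ Spec Ω`, and asks for the Poincaré normalisation `hD` of the FAMILY.  A consumer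
whose `Ω′`-readings sit at morphisms `mᵢ` that are only PROVABLY equal to `x ≫ ℓᵢ` (the sheet points `ℓ_{e′}(y) = Spec σ⁻¹ ≫ ℓ_{σ∘e′}(σ_* y)` of ★
`GaloisThickeningLiftAlongFieldHom`) needs the transfer `Φ` and the moved roof TYPED OVER `mᵢ` (dependent types: `𝒜 ×_Y (x ≫ ℓ)` and `𝒜 ×_Y m` are different
types), and a family base like `X ⊗_F Fᵢ` carries no `IsReduced` instance for ★ `Polarization.nonempty_unitHatSlice_iso`.  Both are bookkeeping: `subst` on
`hm : x ≫ ℓ = m`, and the four pins at the field points in place of `hD` (the ★ proof uses `hD` only through them).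

* §1 `exists_pointsAlong_mulEquiv_of_eq`, `pointsAlong_map_of_eq`, `pointsAlong_forall_map_eq_one_iff_of_eq` — ★ §1 with the target by value;
* §2 **`roof_readAt_comp_of_eq`** — THE HEAD (★ `roof_readAt_comp` with targets by value and pins at the points).

## References
* [GortzWedhorn2020] U. Görtz, T. Wedhorn, *Algebraic Geometry I*, 2nd ed. (2020), Section (4.7) (pp. 107–108), Prop. 4.16 (p. 101).
* [MumfordFogartyKirwan1994] D. Mumford, J. Fogarty, F. Kirwan, *Geometric Invariant Theory*, 3rd ed. (1994), Ch. 6 §1 Cor. 6.4 (p. 117); Ch. 7 §2 Def. 7.2 (p. 129).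
* [MumfordAV1970] D. Mumford, *Abelian Varieties* (1970), §15 Thm. 1 (p. 143).
-/

set_option autoImplicit false

noncomputable section

-- Mathlib's `Over`/pull-back API is stated across semireducible wrappers (as in the ★ parent file).
set_option backward.isDefEq.respectTransparency false

universe u

open CategoryTheory CategoryTheory.Limits AlgebraicGeometry MonoidalCategory
open scoped MonObj Obj

namespace Literature.AlgebraicGeometry.AbelianSchemes

namespace AbelianSchemeOver

open Literature.AlgebraicGeometry.Motives (AlgPoints specOver)

/-! ### §1 The transfer of fibre points with the target morphism by value -/

/-- **THE transfer of fibre points, target morphism BY VALUE**: ★ `exists_pointsAlong_mulEquiv` with `x ≫ ℓ` replaced by any `m = x ≫ ℓ` (so that consumers whose readings sit at a morphism only provably equal to `x ≫ ℓ` — e.g. a sheet point `ℓ_{e′} y` — get `Φ` typed over THEIR morphism; proof: `subst`). [cite: GortzWedhorn2020, Section (4.7) (pp. 107–108)] -/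
theorem exists_pointsAlong_mulEquiv_of_eq {Y : Scheme.{u}} (𝒜 : AbelianSchemeOver Y) {Ω Ω' : Type u} [Field Ω] [Field Ω']
    (ℓ : Spec (.of Ω) ⟶ Y) (x : Spec (.of Ω') ⟶ Spec (.of Ω)) [IsIso x] (m : Spec (.of Ω') ⟶ Y) (hm : x ≫ ℓ = m) :
    ∃ Φ : (𝒜.baseChange ℓ).toAffine.toAbelianVariety.Points Ω ≃* (𝒜.baseChange m).toAffine.toAbelianVariety.Points Ω',
      ∀ P, (Φ P).left ≫ pullback.fst 𝒜.X.hom m = x ≫ P.left ≫ pullback.fst 𝒜.X.hom ℓ := by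
  subst hm
  exact exists_pointsAlong_mulEquiv 𝒜 ℓ x

/-- **Naturality in endomorphisms of the family, target BY VALUE** (★ `pointsAlong_map` after `subst`). [cite: MumfordFogartyKirwan1994, Ch. 6 §1 Corollary 6.4 (p. 117)] -/
theorem pointsAlong_map_of_eq {Y : Scheme.{u}} (𝒜 : AbelianSchemeOver Y) {Ω Ω' : Type u} [Field Ω] [Field Ω']
    (ℓ : Spec (.of Ω) ⟶ Y) (x : Spec (.of Ω') ⟶ Spec (.of Ω)) (m : Spec (.of Ω') ⟶ Y) (hm : x ≫ ℓ = m)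
    {Φ : (𝒜.baseChange ℓ).toAffine.toAbelianVariety.Points Ω → (𝒜.baseChange m).toAffine.toAbelianVariety.Points Ω'}
    (hΦ : ∀ P, (Φ P).left ≫ pullback.fst 𝒜.X.hom m = x ≫ P.left ≫ pullback.fst 𝒜.X.hom ℓ)
    (u : 𝒜.X ⟶ 𝒜.X) (P : (𝒜.baseChange ℓ).toAffine.toAbelianVariety.Points Ω) :
    Φ (AlgPoints.map (baseChangeHom u ℓ) P) =
      (AlgPoints.map (baseChangeHom u m) (Φ P) : (𝒜.baseChange m).toAffine.toAbelianVariety.Points Ω') := by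
  subst hm
  exact pointsAlong_map hΦ u P

/-- **Ideal torsion is detected, target BY VALUE** (★ `pointsAlong_forall_map_eq_one_iff` after `subst`). [cite: MumfordFogartyKirwan1994, Ch. 6 §1 Corollary 6.4 (p. 117)] -/
theorem pointsAlong_forall_map_eq_one_iff_of_eq {Y : Scheme.{u}} (𝒜 : AbelianSchemeOver Y) {Ω Ω' : Type u} [Field Ω] [Field Ω']
    (ℓ : Spec (.of Ω) ⟶ Y) (x : Spec (.of Ω') ⟶ Spec (.of Ω)) [IsIso x] (m : Spec (.of Ω') ⟶ Y) (hm : x ≫ ℓ = m)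
    {Φ : (𝒜.baseChange ℓ).toAffine.toAbelianVariety.Points Ω → (𝒜.baseChange m).toAffine.toAbelianVariety.Points Ω'}
    (hΦ : ∀ P, (Φ P).left ≫ pullback.fst 𝒜.X.hom m = x ≫ P.left ≫ pullback.fst 𝒜.X.hom ℓ)
    {O : Type*} (𝔞 : O → Prop) (act : O → (𝒜.X ⟶ 𝒜.X)) (P : (𝒜.baseChange ℓ).toAffine.toAbelianVariety.Points Ω) :
    (∀ a, 𝔞 a → (AlgPoints.map (baseChangeHom (act a) m) (Φ P) : (𝒜.baseChange m).toAffine.toAbelianVariety.Points Ω') = 1) ↔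
      ∀ a, 𝔞 a → (AlgPoints.map (baseChangeHom (act a) ℓ) P : (𝒜.baseChange ℓ).toAffine.toAbelianVariety.Points Ω) = 1 := by
  subst hm
  exact pointsAlong_forall_map_eq_one_iff hΦ 𝔞 act P

/-! ### §2 The head: the roof read at `(ℓ₁, ℓ₂)` moves to `(m₁, m₂)`, pins at the points -/

set_option maxHeartbeats 400000 in
/-- **THE HEAD — THE ISOGENY ROOF READ AT `(ℓ₁, ℓ₂)` MOVES TO `(m₁, m₂)` FOR ANY `mᵢ = x ≫ ℓᵢ`, WITH POINCARÉ PINS AT THE POINTS**: ★ `roof_readAt_comp` with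
(i) the target morphisms given BY VALUE (`hmᵢ : x ≫ ℓᵢ = mᵢ`, proof by `subst`) and (ii) the Poincaré pin of the FAMILY `D` replaced by the pins of
`D ×_Y ℓ₁`, `D ×_Y ℓ₂`, `D ×_Y m₁`, `D ×_Y m₂` (over field points these come from the base-changed polarisation, ★ `Polarization.nonempty_unitHatSlice_iso`,
while a family base such as `X ⊗_F Fᵢ` need not carry an `IsReduced` instance) — the ★ proof verbatim after `subst`, the two middle-stage pins obtained by
★ `DualPair.nonempty_unitHatSlice_baseChange_iso` along `x`. [cite: MumfordFogartyKirwan1994, Ch. 7 §2 Definition 7.2 (p. 129)] [cite: GortzWedhorn2020, Section (4.7) (pp. 107–108) and Prop. 4.16 (p. 101)]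
[cite: MumfordAV1970, §15 Thm. 1 (p. 143)] -/
theorem roof_readAt_comp_of_eq {Y : Scheme.{u}} (𝒜 : AbelianSchemeOver Y) {O : Type*} [CommRing O] (ρ : RingAction O 𝒜) (D : 𝒜.DualPair)
    (pol : 𝒜.Polarization D) {g n : ℕ} (lvl : 𝒜.LevelStructure g n)
    {Ω Ω' : Type u} [Field Ω] [Field Ω'] (ℓ₁ ℓ₂ : Spec (.of Ω) ⟶ Y) (x : Spec (.of Ω') ⟶ Spec (.of Ω)) [IsIso x]
    (m₁ m₂ : Spec (.of Ω') ⟶ Y) (hm₁ : x ≫ ℓ₁ = m₁) (hm₂ : x ≫ ℓ₂ = m₂)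
    (hpt₁ : Nonempty ((Scheme.Modules.pullback (D.baseChange ℓ₁).unitHatSlice).obj (D.baseChange ℓ₁).P ≅ SheafOfModules.unit _))
    (hpt₂ : Nonempty ((Scheme.Modules.pullback (D.baseChange ℓ₂).unitHatSlice).obj (D.baseChange ℓ₂).P ≅ SheafOfModules.unit _))
    (hD₂ : Nonempty ((Scheme.Modules.pullback (D.baseChange m₁).unitHatSlice).obj (D.baseChange m₁).P ≅ SheafOfModules.unit _))
    (hD₂' : Nonempty ((Scheme.Modules.pullback (D.baseChange m₂).unitHatSlice).obj (D.baseChange m₂).P ≅ SheafOfModules.unit _))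
    (𝔞 : O → Prop) (p : ℕ)
    (K : Subgroup ((𝒜.baseChange ℓ₁).toAffine.toAbelianVariety.Points Ω))
    (K' : Subgroup ((𝒜.baseChange m₁).toAffine.toAbelianVariety.Points Ω'))
    {Φ : (𝒜.baseChange ℓ₁).toAffine.toAbelianVariety.Points Ω → (𝒜.baseChange m₁).toAffine.toAbelianVariety.Points Ω'}
    (hΦ : ∀ P, (Φ P).left ≫ pullback.fst 𝒜.X.hom m₁ = x ≫ P.left ≫ pullback.fst 𝒜.X.hom ℓ₁)
    (hK : ∀ P, Φ P ∈ K' ↔ P ∈ K)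
    (hroof : ∃ (B : AbelianSchemeOver (Spec (.of Ω))) (DB : B.DualPair) (lamB : B.X ⟶ DB.hat.X) (_ : IsMonHom lamB)
        (_ : Nonempty ((Scheme.Modules.pullback DB.unitHatSlice).obj DB.P ≅ SheafOfModules.unit _))
        (q : (𝒜.baseChange ℓ₁).X ⟶ B.X) (_ : IsMonHom q) (c : (𝒜.baseChange ℓ₂).X ⟶ B.X) (_ : IsMonHom c),
        (∀ P : (𝒜.baseChange ℓ₁).toAffine.toAbelianVariety.Points Ω,
            (AlgPoints.map q P : B.toAffine.toAbelianVariety.Points Ω) = 1 ↔ P ∈ K) ∧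
        (∀ P : (𝒜.baseChange ℓ₂).toAffine.toAbelianVariety.Points Ω,
            (AlgPoints.map c P : B.toAffine.toAbelianVariety.Points Ω) = 1 ↔
              ∀ a, 𝔞 a → (AlgPoints.map (baseChangeHom (ρ.i a) ℓ₂) P : (𝒜.baseChange ℓ₂).toAffine.toAbelianVariety.Points Ω) = 1) ∧
        Function.Surjective c.left.base ∧
        q ≫ lamB ≫ DualPair.dualIsogenyOver q (D.baseChange ℓ₁) DB = (pol.baseChange ℓ₁).lam ≫ (D.baseChange ℓ₁).hat.mulN p ∧
        c ≫ lamB ≫ DualPair.dualIsogenyOver c (D.baseChange ℓ₂) DB = (pol.baseChange ℓ₂).lam ≫ (D.baseChange ℓ₂).hat.mulN p ∧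
        (∀ a : O, ∃ b : B.X ⟶ B.X, baseChangeHom (ρ.i a) ℓ₁ ≫ q = q ≫ b ∧ baseChangeHom (ρ.i a) ℓ₂ ≫ c = c ≫ b) ∧
        (∀ a : Fin g ⊕ Fin g → ZMod n,
          (AlgPoints.map q (𝒜.restrictPt ℓ₁ (lvl.section_ a)) : B.toAffine.toAbelianVariety.Points Ω) =
            AlgPoints.map c (𝒜.restrictPt ℓ₂ (lvl.section_ a)))) :
    ∃ (B : AbelianSchemeOver (Spec (.of Ω'))) (DB : B.DualPair) (lamB : B.X ⟶ DB.hat.X) (_ : IsMonHom lamB)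
        (_ : Nonempty ((Scheme.Modules.pullback DB.unitHatSlice).obj DB.P ≅ SheafOfModules.unit _))
        (q : (𝒜.baseChange m₁).X ⟶ B.X) (_ : IsMonHom q) (c : (𝒜.baseChange m₂).X ⟶ B.X) (_ : IsMonHom c),
        (∀ P : (𝒜.baseChange m₁).toAffine.toAbelianVariety.Points Ω',
            (AlgPoints.map q P : B.toAffine.toAbelianVariety.Points Ω') = 1 ↔ P ∈ K') ∧
        (∀ P : (𝒜.baseChange m₂).toAffine.toAbelianVariety.Points Ω',
            (AlgPoints.map c P : B.toAffine.toAbelianVariety.Points Ω') = 1 ↔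
              ∀ a, 𝔞 a → (AlgPoints.map (baseChangeHom (ρ.i a) m₂) P :
                (𝒜.baseChange m₂).toAffine.toAbelianVariety.Points Ω') = 1) ∧
        Function.Surjective c.left.base ∧
        q ≫ lamB ≫ DualPair.dualIsogenyOver q (D.baseChange m₁) DB =
          (pol.baseChange m₁).lam ≫ (D.baseChange m₁).hat.mulN p ∧
        c ≫ lamB ≫ DualPair.dualIsogenyOver c (D.baseChange m₂) DB =
          (pol.baseChange m₂).lam ≫ (D.baseChange m₂).hat.mulN p ∧
        (∀ a : O, ∃ b : B.X ⟶ B.X, baseChangeHom (ρ.i a) m₁ ≫ q = q ≫ b ∧ baseChangeHom (ρ.i a) m₂ ≫ c = c ≫ b) ∧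
        (∀ a : Fin g ⊕ Fin g → ZMod n,
          (AlgPoints.map q (𝒜.restrictPt m₁ (lvl.section_ a)) : B.toAffine.toAbelianVariety.Points Ω') =
            AlgPoints.map c (𝒜.restrictPt m₂ (lvl.section_ a))) := by
  subst hm₁ hm₂
  classical
  -- transfers along `x`
  obtain ⟨ε₁, hε₁⟩ := exists_pointsTransfer x (𝒜.baseChange ℓ₁)
  obtain ⟨ε₂, hε₂⟩ := exists_pointsTransfer x (𝒜.baseChange ℓ₂)
  -- Poincaré pins of the base-changed dual pairs (from the point pins)
  have hD₁ := DualPair.nonempty_unitHatSlice_baseChange_iso (g := x) (D.baseChange ℓ₁) hpt₁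
  have hD₁' := DualPair.nonempty_unitHatSlice_baseChange_iso (g := x) (D.baseChange ℓ₂) hpt₂
  -- the exact comparison isomorphisms `(𝒜 ×_Y ℓᵢ) ×_Ω Spec Ω′ ≅ 𝒜 ×_Y (x ≫ ℓᵢ)`
  obtain ⟨e₁, he₁mon, he₁left, -, he₁lam, he₁σ, he₁act⟩ := exists_iso_of_tupleRel_id ((D.baseChange ℓ₁).baseChange x) (D.baseChange (x ≫ ℓ₁))
    (baseChangeHom (pol.baseChange ℓ₁).lam x) (pol.baseChange (x ≫ ℓ₁)).lam hD₂ ((lvl.baseChange ℓ₁).baseChange x) (lvl.baseChange (x ≫ ℓ₁))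
    (fun a => baseChangeHom (baseChangeHom (ρ.i a) ℓ₁) x) (fun a => baseChangeHom (ρ.i a) (x ≫ ℓ₁))
    (tupleRel_baseChangeCompGrpIso_inv 𝒜 ρ D pol lvl ℓ₁ x)
  obtain ⟨e₂, he₂mon, he₂left, -, he₂lam, he₂σ, he₂act⟩ := exists_iso_of_tupleRel_id ((D.baseChange ℓ₂).baseChange x) (D.baseChange (x ≫ ℓ₂))
    (baseChangeHom (pol.baseChange ℓ₂).lam x) (pol.baseChange (x ≫ ℓ₂)).lam hD₂' ((lvl.baseChange ℓ₂).baseChange x) (lvl.baseChange (x ≫ ℓ₂))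
    (fun a => baseChangeHom (baseChangeHom (ρ.i a) ℓ₂) x) (fun a => baseChangeHom (ρ.i a) (x ≫ ℓ₂))
    (tupleRel_baseChangeCompGrpIso_inv 𝒜 ρ D pol lvl ℓ₂ x)
  haveI := he₁mon
  haveI := he₂mon
  -- the kernel subgroup in the middle stage: pull `K′` back along the points of `e₁`
  obtain ⟨φ₁, hφ₁, -⟩ := exists_mulEquiv_points_of_iso e₁
  have hΦε : ∀ P, Φ P = φ₁ (ε₁ P) := fun P => by
    rw [hφ₁]
    exact pointsAlong_eq_map_pointsTransfer hΦ hε₁ e₁.hom he₁left P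
  -- (1) base change of the roof along `x`
  have hbc := roof_baseChange_of_isIso (e := x) (D.baseChange ℓ₁) (D.baseChange ℓ₂) (pol.baseChange ℓ₁).lam (pol.baseChange ℓ₂).lam
    (fun a => baseChangeHom (ρ.i a) ℓ₁) (fun a => baseChangeHom (ρ.i a) ℓ₂)
    (fun a : Fin g ⊕ Fin g → ZMod n => (𝒜.restrictPt ℓ₁ (lvl.section_ a) : (𝒜.baseChange ℓ₁).toAffine.toAbelianVariety.Points Ω))
    (fun a : Fin g ⊕ Fin g → ZMod n => (𝒜.restrictPt ℓ₂ (lvl.section_ a) : (𝒜.baseChange ℓ₂).toAffine.toAbelianVariety.Points Ω))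
    (fun P => ∀ a, 𝔞 a → (AlgPoints.map (baseChangeHom (ρ.i a) ℓ₂) P : (𝒜.baseChange ℓ₂).toAffine.toAbelianVariety.Points Ω) = 1)
    K p hε₁ hε₂ (fun a => ε₁ (𝒜.restrictPt ℓ₁ (lvl.section_ a))) (fun a => ε₂ (𝒜.restrictPt ℓ₂ (lvl.section_ a)))
    (fun Q => ∀ a, 𝔞 a → (AlgPoints.map (baseChangeHom (baseChangeHom (ρ.i a) ℓ₂) x) Q :
      ((𝒜.baseChange ℓ₂).baseChange x).toAffine.toAbelianVariety.Points Ω') = 1)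
    (K'.comap φ₁.toMonoidHom) (fun _ => rfl) (fun _ => rfl)
    (fun P => pointsTransfer_forall_map_eq_one_iff hε₂ 𝔞 (fun a => baseChangeHom (ρ.i a) ℓ₂) P)
    (fun P => by rw [Subgroup.mem_comap, MulEquiv.coe_toMonoidHom, ← hΦε, hK]) hroof
  -- (3) transport along the exact isomorphisms
  exact roof_transport_along_iso ((D.baseChange ℓ₁).baseChange x) (D.baseChange (x ≫ ℓ₁)) ((D.baseChange ℓ₂).baseChange x) (D.baseChange (x ≫ ℓ₂))
    hD₁ hD₂ hD₁' hD₂' (baseChangeHom (pol.baseChange ℓ₁).lam x) (pol.baseChange (x ≫ ℓ₁)).lam (baseChangeHom (pol.baseChange ℓ₂).lam x) (pol.baseChange (x ≫ ℓ₂)).lam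
    (fun a => baseChangeHom (baseChangeHom (ρ.i a) ℓ₁) x) (fun a => baseChangeHom (ρ.i a) (x ≫ ℓ₁))
    (fun a => baseChangeHom (baseChangeHom (ρ.i a) ℓ₂) x) (fun a => baseChangeHom (ρ.i a) (x ≫ ℓ₂))
    (fun a => ε₁ (𝒜.restrictPt ℓ₁ (lvl.section_ a))) (fun a => 𝒜.restrictPt (x ≫ ℓ₁) (lvl.section_ a))
    (fun a => ε₂ (𝒜.restrictPt ℓ₂ (lvl.section_ a))) (fun a => 𝒜.restrictPt (x ≫ ℓ₂) (lvl.section_ a))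
    (fun Q => ∀ a, 𝔞 a → (AlgPoints.map (baseChangeHom (baseChangeHom (ρ.i a) ℓ₂) x) Q :
      ((𝒜.baseChange ℓ₂).baseChange x).toAffine.toAbelianVariety.Points Ω') = 1)
    (fun Q => ∀ a, 𝔞 a → (AlgPoints.map (baseChangeHom (ρ.i a) (x ≫ ℓ₂)) Q :
      (𝒜.baseChange (x ≫ ℓ₂)).toAffine.toAbelianVariety.Points Ω') = 1)
    (K'.comap φ₁.toMonoidHom) K' e₁ e₂ p he₁lam he₂lam he₁act he₂act
    (fun a => 𝒜.map_pointsTransfer_restrictPt_of_left_eq_baseChangeCompGrpIso_inv ℓ₁ x hε₁ e₁.hom he₁left (lvl.section_ a))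
    (fun a => 𝒜.map_pointsTransfer_restrictPt_of_left_eq_baseChangeCompGrpIso_inv ℓ₂ x hε₂ e₂.hom he₂left (lvl.section_ a))
    (fun Q => forall_map_eq_one_iff_of_iso_inv e₂ 𝔞 (fun a => baseChangeHom (baseChangeHom (ρ.i a) ℓ₂) x)
      (fun a => baseChangeHom (ρ.i a) (x ≫ ℓ₂)) he₂act Q)
    (fun Q => by rw [Subgroup.mem_comap, MulEquiv.coe_toMonoidHom, hφ₁, map_hom_map_inv]) hbc


end AbelianSchemeOver

end Literature.AlgebraicGeometry.AbelianSchemes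

end
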